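import Summits.BirchSwinnertonDyer.BirchSwinnertonDyer.Theorems.ClassRecordThreeCornerAtThreeUpperShimuraAnchorTail
import Summits.BirchSwinnertonDyer.BirchSwinnertonDyer.Theorems.ClassRecordThreeCornerAtThreeShape
import Summits.BirchSwinnertonDyer.BirchSwinnertonDyer.Theorems.ClassRecordThreeCornerAtThreeCoChainDefs
import HarnessLib

/-!
# Crux `CornerAtThreeW` (item stmt-BirchSwinnertonDyer-21420; routes `ClassRecordThree` ∕ `KolyvaginRoadThree`; 19111 `CornerAtThree` aside), conjunct (U):
# THE IMC-GRADE TAIL OF THE LINE IS EMPTY — every multi-carrier (T4″)₃ corner curve is admissible-anchor as it stands or up to one exempted place,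
# so conjunct 2 of `stub_upper3_residualMulti` (r14) is a THEOREM (vacuously), class-wide, no cited input
# (cell `bsd-stepL`, seat `bsd-stepL-corner3-p2` g13 = WIDTH-LEVER lane B; `--supports stmt-BirchSwinnertonDyer-21420 --as helper`)

WHAT. Two kernel theorems of this seat are composed:
* lane B g12's TAIL LEMMA `Three.cornerInertAdmissibleAnchor_or_upToOne_of_multiCarrier_of_shape` (`…UpperShimuraAnchorTail`, p633780): a multi-carrier
  corner curve with the Tamagawa SHAPE (`∀ q, 3 ∣ c(E ⊗ ℚ_q) → E split multiplicative at q`) is `Three.CornerInertAdmissibleAnchor` or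
  `Three.CornerInertAdmissibleUpToOneAnchor` (finite-set bookkeeping on the split offenders, the `3`-anchor of Pasten's Lemma 6.18);
* lane B g4's SHAPE THEOREM `Three.hasSplitMultiplicativeReductionAtPrime_of_three_dvd_of_not_surj` (`…CornerAtThreeShape`, 2026-08-27): on the
  corner `ClassX11b W 3 ∧ ¬ Surj W 3` the Tamagawa shape HOLDS at every prime — no additive place has `3 ∣ c_v` (`ρ̄_{E,3}(Γ_ℚ)` has order prime
  to `3` by Serre's Prop. 15, `det ρ̄ = χ̄₃ = 1` on inertia at `v ∤ 3`, an inertia involution of determinant `1` is `−1`, and a `ℚ_v`-rational point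
  of order `3` from `3 ∣ c_v` would be fixed by it), `ℓ = 2` included, unconditionally.
Hence (`Three.cornerInertAdmissibleAnchor_or_upToOneAnchor_of_multiCarrier_of_not_surj`) EVERY multi-carrier corner curve is admissible-anchor one way or
the other, the population «multi-carrier ∧ ¬ AdmissibleAnchor ∧ ¬ UpToOneAnchor» on which r14's `stub_upper3_residualMulti` conjunct 2 asks the
anticyclotomic «⊇» half `Three.CornerCoStepLAt W` is EMPTY (`Three.cornerTailAnchor_false`), and that conjunct is a theorem as it stands
(`Three.cornerCoStepLAt_of_multiCarrier_of_not_anchor`, the stub text VERBATIM; `Three.missingUpperBoundAt_of_multiCarrier_of_not_anchor`, the shape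
read by the skeleton's `residual3_of_stubs`). Consequence for the line of record `Cruxes/CornerAtThreeW/Lines/inert.lean`: after r14 the (U)-side of the
corner has NO main-conjecture-grade input at all — what is not print is the (B6) label of the CM family of `X_{N⁺,N⁻}` at the exempted (K-split)
carrier of the up-to-one frames, the twin-lower supply, and the mono branch's two image-free Gross facts on the `Mult = {3}` curves (r15, this seat).
g12's census note «class-wide non-empty (additive IV ∕ IV* `3`-carrier)» for the tail is hereby CORRECTED: class-wide EMPTY, by g4's theorem.

HONEST FRAMING: THEOREMS ONLY (no definition, no named fact, no `sorry`); two existing kernel theorems composed; nothing about any L-value, Selmer group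
or Heegner point is proved here; nothing here is a BSD class theorem; no census label moves (T7); 21420 ∕ 19111 NOT closed; BSD is proved for no curve.
Credit: lane B g4 (shape theorem), lane B g12 (tail lemma), idea-crit-14 ∕ bsd-idea-9 ∕ LEAD er5-p1 ∕ w2 (the anchor), corner-p1 g17, x11b3, tam3-p1.
References (locators only): [cite: PastenShimura2024, Lemmas 6.15, 6.16 and 6.18 (arXiv v4 pp. 30–33)] [cite: Jetchev2008, Thm. 1.1, Cor. 1.5]
[cite: Serre1972, §2.4 Prop. 15 and §2.5] [cite: SilvermanAEC2009, Thm. VII.6.1 and proof of Thm. VII.7.1] [cite: SilvermanATAEC1994, Cor. IV.9.2 (d) and Table 4.1].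
-/

set_option autoImplicit false
set_option linter.dupNamespace false -- `Summit.BirchSwinnertonDyer.BirchSwinnertonDyer` (summit = problem), tree-wide

noncomputable section

open scoped Classical NumberField

open WeierstrassCurve NumberField IsDedekindDomain CongruenceSubgroup Literature.NumberTheory.EllipticCurves
  Literature.NumberTheory.EllipticCurves.ModularForms Literature.NumberTheory.Automorphic
  Literature.NumberTheory.EllipticCurves.Rank1Residual Literature.NumberTheory.EllipticCurves.Rank1Residual.Typed
  Literature.NumberTheory.EllipticCurves.BarriosEtAl2025
  Summit.BirchSwinnertonDyer.Rank1Residual Summit.BirchSwinnertonDyer.Rank1Residual.X11b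

namespace Summit.BirchSwinnertonDyer.BirchSwinnertonDyer.Theorems

/-! ### §1. Every multi-carrier corner curve is admissible-anchor, as it stands or up to one exempted place -/

/-- **The dichotomy, class-wide on the corner**: a multi-carrier (T4″)₃ corner curve (`ClassX11b W 3`, `ρ̄_{E,3}` not onto, `∀ v, ord₃ c_v < ord₃ ∏c`)
is `Three.CornerInertAdmissibleAnchor` or `Three.CornerInertAdmissibleUpToOneAnchor` — the tail lemma (lane B g12) with its Tamagawa-shape binder
DISCHARGED by the shape theorem of the corner (lane B g4: no prime with `3 ∣ c_q` fails to be split multiplicative when `E[3]` is irreducible and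
`ρ̄_{E,3}` is not onto). Bookkeeping on two kernel theorems; nothing asserted about BSD.
[cite: PastenShimura2024, Lemmas 6.15, 6.16 and 6.18] [cite: Jetchev2008, Cor. 1.5] [cite: Serre1972, §2.4 Prop. 15] -/
theorem Three.cornerInertAdmissibleAnchor_or_upToOneAnchor_of_multiCarrier_of_not_surj
    (W : WeierstrassCurve ℚ) [W.IsElliptic] [W.IsGloballyMinimal] (hX : ClassX11b W 3) (hns : ¬ Surj W 3)
    (hmulti : ∀ v : HeightOneSpectrum (𝓞 ℚ), padicValNat 3 (W.tamagawaNumberAt v) < padicValNat 3 W.tamagawaProduct) :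
    Three.CornerInertAdmissibleAnchor W ∨ Three.CornerInertAdmissibleUpToOneAnchor W := by
  haveI : Fact (Nat.Prime 3) := ⟨Nat.prime_three⟩
  exact Three.cornerInertAdmissibleAnchor_or_upToOne_of_multiCarrier_of_shape W hX hmulti
    (fun q _ h3 ↦ Three.hasSplitMultiplicativeReductionAtPrime_of_three_dvd_of_not_surj W hX hns q h3)

/-- **The IMC-grade tail of the line is EMPTY**: no multi-carrier corner curve is admissible-anchor NEITHER as it stands NOR up to one exempted
place. (g12's `Three.cornerTailAnchor_shape` produces a prime with `3 ∣ c_q` that is not split multiplicative; g4's shape theorem says there is none.)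
Corrects g12's informal note «class-wide non-empty»: the additive IV ∕ IV* `3`-carrier cannot occur on the corner (the mod-`3` image is a `2`-group).
[cite: Serre1972, §2.4 Prop. 15 and §2.5] [cite: SilvermanATAEC1994, Cor. IV.9.2 (d) and Table 4.1] -/
theorem Three.cornerTailAnchor_false (W : WeierstrassCurve ℚ) [W.IsElliptic] [W.IsGloballyMinimal] (hX : ClassX11b W 3) (hns : ¬ Surj W 3)
    (hmulti : ∀ v : HeightOneSpectrum (𝓞 ℚ), padicValNat 3 (W.tamagawaNumberAt v) < padicValNat 3 W.tamagawaProduct)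
    (hnadm : ¬ Three.CornerInertAdmissibleAnchor W) (hnadm1 : ¬ Three.CornerInertAdmissibleUpToOneAnchor W) : False := by
  rcases Three.cornerInertAdmissibleAnchor_or_upToOneAnchor_of_multiCarrier_of_not_surj W hX hns hmulti with h | h
  · exact hnadm h
  · exact hnadm1 h

/-! ### §2. Conjunct 2 of r14's `stub_upper3_residualMulti` is a theorem (vacuously) -/

/-- **Conjunct 2 of `stub_upper3_residualMulti` (line `Cruxes/CornerAtThreeW/Lines/inert.lean` r14), VERBATIM, PROVED**: for every globally minimal
elliptic `W/ℚ` that is multi-carrier at `3` and admissible-anchor neither as it stands nor up to one exempted place, `Three.CornerCoStepLAt W` — because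
`Three.CornerCoStepLAt W` carries `ClassX11b W 3 → ¬ Surj W 3 → …` among its antecedents, under which that population is empty (§1). VACUOUS: no
anticyclotomic divisibility is proved; the conjunct simply binds nothing. [cite: Castella2018, Thm. 3.2 (shape only; nothing asserted)]
[cite: Serre1972, §2.4 Prop. 15] [cite: PastenShimura2024, Lemma 6.18] -/
theorem Three.cornerCoStepLAt_of_multiCarrier_of_not_anchor :
    ∀ (W : WeierstrassCurve ℚ) [W.IsElliptic] [W.IsGloballyMinimal],
      (∀ v : HeightOneSpectrum (𝓞 ℚ),
        padicValNat 3 (W.tamagawaNumberAt v) < padicValNat 3 W.tamagawaProduct) →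
      ¬ Three.CornerInertAdmissibleAnchor W → ¬ Three.CornerInertAdmissibleUpToOneAnchor W → Three.CornerCoStepLAt W := by
  intro W _ _ hmulti hnadm hnadm1 N _ K _ _ Dt H ι P hX hns
  exact (Three.cornerTailAnchor_false W hX hns hmulti hnadm hnadm1).elim

/-- **The multi-carrier branch of the line's residual binder is vacuous**: in the shape read by the skeleton's `residual3_of_stubs` and by the
one-call consumer `cornerAtThreeUpperConsumed_of_primitivesDivAtThreeInertD_of_displays_of_residualAnchor_of_twinLower` (`…UpperShimuraAnchorGlue`,
binder `hres`), the `ℚ`-level Euler-system half `Typed.MissingUpperBoundAt W 3` on a multi-carrier corner curve admissible-anchor neither way holds —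
there is no such curve (§1). So `hres` bites only on the MONO-carrier corner curves admissible-anchor neither way (the `Mult = {3}` curves, served by the
X₀(N) Jetchev MAX walk of the mono branch). VACUOUS; nothing asserted about BSD. [cite: Jetchev2008, Thm. 1.1, Cor. 1.5 (shape)] [cite: Serre1972, §2.4 Prop. 15] -/
theorem Three.missingUpperBoundAt_of_multiCarrier_of_not_anchor (W : WeierstrassCurve ℚ) [W.IsElliptic] [W.IsGloballyMinimal]
    (hX : ClassX11b W 3) (hns : ¬ Surj W 3)
    (hmulti : ∀ v : HeightOneSpectrum (𝓞 ℚ), padicValNat 3 (W.tamagawaNumberAt v) < padicValNat 3 W.tamagawaProduct)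
    (hnadm : ¬ Three.CornerInertAdmissibleAnchor W) (hnadm1 : ¬ Three.CornerInertAdmissibleUpToOneAnchor W) :
    Typed.MissingUpperBoundAt W 3 :=
  (Three.cornerTailAnchor_false W hX hns hmulti hnadm hnadm1).elim

end Summit.BirchSwinnertonDyer.BirchSwinnertonDyer.Theorems

end
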